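import Literature.Geometry.Riemannian.RoundCylinderFourSoliton
import HarnessLib

/-!
# The round cylinder `S²(√2) × ℝ` as the conformally flat metric `(2/|y|²) δ` on `ℝ³ ∖ {0}`:
# metric, curvature, and the normalised shrinking soliton structure (topic `Geometry/Riemannian`)

The three-dimensional analogue of `RoundCylinderFour.lean` / `RoundCylinderFourSoliton.lean`. The
round cylinder of radius `√2`, `S²(√2) × ℝ` with `g = 2 g_{S²} + dz²`, is isometric to the punctured
space `ℝ³ ∖ {0}` with the conformally flat metric `g_c = (2/|y|²) δ = e^{2u} δ`,
`u = ½ log 2 − log |y|`, `z = √2 log |y|` (`dt² + g_{S²} = ρ⁻²(dρ² + ρ² g_{S²})`, `ρ = eᵗ`, scaled by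
`2`). It is the model non-compact non-flat gradient shrinking Ricci soliton of dimension three
(Cao–Chen–Zhu 2008, Prop. 4.7: every complete noncompact non-flat three-dimensional shrinker is one
of its quotients; Munteanu–Wang 2016, Thm. 1.2): with `f = z²/4 + 1 = (log|y|)²/2 + 1`,
`Ric + Hess f = ½ g_c`, `R + |∇f|² = f`, `R ≡ 1`, and `Ric` has the null direction `∂_z` (the
radial direction `y`). This file PROVES, in the tree's vocabulary:

* `punctured`, `P3` — `ℝ³ ∖ {0}` as an `Opens` / open submanifold of `E3 = EuclideanSpace ℝ (Fin 3)`;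
  `uE` — the exponent with `e^{2u} = 2/|y|²` (`exp_two_uE`) and its calculus;
* `flat3`, `cyl3` — `δ` and `g_c = e^{2u} δ` as smooth `PseudoRiemannianMetric`s on `P3`,
  Riemannian, with Levi-Civita instances;
* **`ricci_cyl3`** — `Ric(g_c)(Y,Z) = ⟪Y,Z⟫/|x|² − ⟪x,Y⟫⟪x,Z⟫/|x|⁴` (`= ½ g_c − ½ dz⊗dz`,
  `dz = √2⟪x,·⟫/|x|²`), by Besse's conformal law (`OpensChart.ricci_conformalRepr_exp`);
  **`scalarCurvature_cyl3`** — `R(g_c) = 1`; **`ricci_cyl3_pos`** — `Ric(·, y) = 0`: the radial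
  direction is `Ric`-null (the soliton is DEGENERATE in the sense of
  `ThreeShrinkerDegenerateLocalStructure.lean`);
* `fP = (log|y|)²/2 + 1`, **`hessian_cyl3_fP_self`** (`Hess_{g_c} f(u,u) = ⟪x,u⟫²/|x|⁴ = ½ dz(u)²`),
  **`soliton`** (`Ric + Hess f = ½ g_c`), **`gradSq_cyl3_fP`** (`|∇f|² = (log|y|)²/2`),
  **`normalisation`** (`R + |∇f|² = f`); `NoncompactSpace P3`, `ConnectedSpace P3`.

The weighted volume `∫ e^{-f} dV = 16π√π e^{-1}` — the constant of disjunct (b) of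
`threeShrinkerClassification_modelData` — and completeness are in `RoundCylinderThreeVolume.lean`.
Everything is proved; no definitions of `Prop` type, no named facts (D-0026).

## References

* H.-D. Cao, B.-L. Chen, X.-P. Zhu, Surveys in Differential Geometry XII (2008), Prop. 4.7 (p. 78)
  (the round neck `S² × ℝ`). [CaoChenZhu2007]
* O. Munteanu, J. Wang, arXiv:1606.01861, Thm. 1.2 (p. 3). [MunteanuWang2016]
* A. L. Besse, *Einstein manifolds*, Springer 1987, Thm. 1.159 (conformal changes). [Besse1987]
* P. Petersen, *Riemannian Geometry*, 3rd ed., Springer 2016, §4.2.3 (the cylinder as a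
  conformally flat metric). [Petersen2016]
-/

noncomputable section

open Bundle Set Function Filter Manifold Metric Module TopologicalSpace
open scoped Manifold ContDiff Topology RealInnerProductSpace ENNReal NNReal

namespace Literature.Geometry.Riemannian

open Lorentzian Lorentzian.PseudoRiemannianMetric

namespace RoundCylinderThree

/-! ### The punctured space `ℝ³ ∖ {0}` -/

/-- `ℝ³ ∖ {0}` as an open subset of `E3 = EuclideanSpace ℝ (Fin 3)`. [folklore] -/
def punctured : Opens E3 := ⟨{(0 : E3)}ᶜ, isOpen_compl_singleton⟩

/-- `ℝ³ ∖ {0}` as a type (an open submanifold of `ℝ³`, charts = the inclusion). [folklore] -/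
abbrev P3 : Type := punctured

/-- Points of `ℝ³ ∖ {0}` are nonzero. [folklore] -/
theorem coe_ne_zero (y : P3) : (y : E3) ≠ 0 := fun h ↦ y.2 (by
  rw [h]; exact rfl)

/-- Points of `ℝ³ ∖ {0}` have positive norm. [folklore] -/
theorem norm_pos (y : P3) : 0 < ‖(y : E3)‖ := norm_pos_iff.mpr (coe_ne_zero y)

/-- Points of `ℝ³ ∖ {0}` have positive squared norm. [folklore] -/
theorem normSq_pos (y : P3) : 0 < ‖(y : E3)‖ ^ 2 := pow_pos (norm_pos y) 2

/-! ### The conformal exponent `u(y) = ½ log 2 − ½ log |y|²`, `e^{2u} = 2/|y|²` -/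

/-- `u(y) = ½ log 2 − ½ log |y|²` (total on `ℝ³`, junk at `0`). [folklore] -/
def uE (y : E3) : ℝ := 2⁻¹ * Real.log 2 - 2⁻¹ * Real.log (‖y‖ ^ 2)

/-- `e^{2u} = 2/|y|²`. [folklore] -/
theorem exp_two_uE {y : E3} (hy : y ≠ 0) : Real.exp (2 * uE y) = 2 / ‖y‖ ^ 2 := by
  have hy2 : 0 < ‖y‖ ^ 2 := pow_pos (norm_pos_iff.mpr hy) 2
  have h : 2 * uE y = Real.log 2 - Real.log (‖y‖ ^ 2) := by rw [uE]; ring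
  rw [h, Real.exp_sub, Real.exp_log (by norm_num), Real.exp_log hy2]

/-- `u` is smooth off the origin. [folklore] -/
theorem contDiffAt_uE {y : E3} (hy : y ≠ 0) {n : ℕ∞ω} : ContDiffAt ℝ n uE y := by
  have h1 : ContDiffAt ℝ n (fun y : E3 ↦ ‖y‖ ^ 2) y := (contDiff_norm_sq ℝ).contDiffAt
  have h2 : ContDiffAt ℝ n (fun y : E3 ↦ Real.log (‖y‖ ^ 2)) y := by
    exact (Real.contDiffAt_log.mpr (pow_pos (norm_pos_iff.mpr hy) 2).ne').comp y h1
  exact contDiffAt_const.sub (contDiffAt_const.mul h2)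

/-- `u` is smooth on `{y ≠ 0}`. [folklore] -/
theorem contDiffOn_uE {n : ℕ∞ω} : ContDiffOn ℝ n uE {y : E3 | y ≠ 0} :=
  fun _ hy ↦ (contDiffAt_uE hy).contDiffWithinAt

/-! ### Calculus of `u`: first and second derivatives -/

/-- `du_y = −|y|⁻² ⟪y, ·⟫`. [folklore] -/
theorem hasFDerivAt_uE {y : E3} (hy : y ≠ 0) :
    HasFDerivAt uE (-(‖y‖ ^ 2)⁻¹ • innerSL ℝ y) y := by
  have hy2 : ‖y‖ ^ 2 ≠ 0 := (pow_pos (norm_pos_iff.mpr hy) 2).ne'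
  have h1 : HasFDerivAt (fun y : E3 ↦ ‖y‖ ^ 2) (2 • innerSL ℝ y) y :=
    (hasStrictFDerivAt_norm_sq y).hasFDerivAt
  have h2 : HasFDerivAt (fun y : E3 ↦ Real.log (‖y‖ ^ 2)) ((‖y‖ ^ 2)⁻¹ • (2 • innerSL ℝ y)) y := by
    exact (Real.hasDerivAt_log hy2).comp_hasFDerivAt y h1
  have h3 := (h2.const_mul (2⁻¹ : ℝ)).const_sub (2⁻¹ * Real.log 2)
  refine h3.congr_fderiv ?_
  ext v
  simp only [neg_apply, smul_apply, innerSL_apply_apply, smul_eq_mul, nsmul_eq_mul,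
    Nat.cast_ofNat]
  field_simp

/-- `du_y(v) = −⟪y,v⟫/|y|²`. [folklore] -/
theorem fderiv_uE_apply {y : E3} (hy : y ≠ 0) (v : E3) :
    fderiv ℝ uE y v = -⟪y, v⟫ / ‖y‖ ^ 2 := by
  rw [(hasFDerivAt_uE hy).fderiv, smul_apply, innerSL_apply_apply, smul_eq_mul]
  ring

/-- The first derivative as a function, on `{y ≠ 0}`. [folklore] -/
theorem fderiv_uE_eventuallyEq {x : E3} (hx : x ≠ 0) :
    fderiv ℝ uE =ᶠ[𝓝 x] fun y ↦ -(‖y‖ ^ 2)⁻¹ • innerSL ℝ y := by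
  filter_upwards [isOpen_compl_singleton.mem_nhds hx] with y hy
  exact (hasFDerivAt_uE hy).fderiv

/-- The derivative of `y ↦ −|y|⁻² ⟪y,·⟫` at `x`. [folklore] -/
theorem hasFDerivAt_duE {x : E3} (hx : x ≠ 0) :
    HasFDerivAt (fun y : E3 ↦ -(‖y‖ ^ 2)⁻¹ • innerSL ℝ y)
      ((-(‖x‖ ^ 2)⁻¹) • (innerSL ℝ : E3 →L[ℝ] E3 →L[ℝ] ℝ) +
        (((‖x‖ ^ 2)⁻¹ ^ 2) • (2 • innerSL ℝ x)).smulRight (innerSL ℝ x)) x := by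
  have hx2 : ‖x‖ ^ 2 ≠ 0 := (pow_pos (norm_pos_iff.mpr hx) 2).ne'
  have h1 : HasFDerivAt (fun y : E3 ↦ ‖y‖ ^ 2) (2 • innerSL ℝ x) x :=
    (hasStrictFDerivAt_norm_sq x).hasFDerivAt
  have h2 : HasFDerivAt (fun y : E3 ↦ -(‖y‖ ^ 2)⁻¹) (((‖x‖ ^ 2)⁻¹ ^ 2) • (2 • innerSL ℝ x)) x := by
    have h := ((hasDerivAt_inv hx2).comp_hasFDerivAt x h1).neg
    refine h.congr_fderiv ?_
    ext v
    simp only [neg_apply, smul_apply, smul_eq_mul, nsmul_eq_mul, Nat.cast_ofNat,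
      innerSL_apply_apply]
    field_simp
  have h3 : HasFDerivAt (fun y : E3 ↦ (innerSL ℝ y : E3 →L[ℝ] ℝ))
      (innerSL ℝ : E3 →L[ℝ] E3 →L[ℝ] ℝ) x :=
    (innerSL ℝ : E3 →L[ℝ] E3 →L[ℝ] ℝ).hasFDerivAt
  exact h2.smul h3

/-- `D²u_x(Y,Z) = −⟪Y,Z⟫/|x|² + 2⟪x,Y⟫⟪x,Z⟫/|x|⁴`. [folklore] -/
theorem fderiv_fderiv_uE_apply {x : E3} (hx : x ≠ 0) (Y Z : E3) :
    fderiv ℝ (fderiv ℝ uE) x Y Z = -⟪Y, Z⟫ / ‖x‖ ^ 2 + 2 * ⟪x, Y⟫ * ⟪x, Z⟫ / ‖x‖ ^ 4 := by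
  rw [(fderiv_uE_eventuallyEq hx).fderiv_eq, (hasFDerivAt_duE hx).fderiv]
  simp only [add_apply, smul_apply, innerSL_apply_apply, smul_eq_mul,
    ContinuousLinearMap.smulRight_apply, nsmul_eq_mul, Nat.cast_ofNat]
  have e : (innerSL ℝ : E3 →L[ℝ] E3 →L[ℝ] ℝ) Y Z = ⟪Y, Z⟫ := rfl
  rw [e]
  field_simp

/-! ### The flat metric `δ` and the cylinder metric `(2/|y|²) δ` on `ℝ³ ∖ {0}` -/

/-- Constant representative `δ`. [folklore] -/
abbrev G0 : E3 → E3 →L[ℝ] E3 →L[ℝ] ℝ := fun _ ↦ innerSL ℝ (E := E3)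

/-- Representative `e^{2u} δ = (2/|y|²) δ` of the cylinder metric. [folklore] -/
abbrev Gc : E3 → E3 →L[ℝ] E3 →L[ℝ] ℝ := fun y ↦ Real.exp (2 * uE y) • innerSL ℝ (E := E3)

/-- `Gc` is smooth off the origin. [folklore] -/
theorem contDiffOn_Gc : ContDiffOn ℝ ∞ Gc {y : E3 | y ≠ 0} :=
  contDiffOn_smul_const' (Real.contDiff_exp.comp_contDiffOn (contDiffOn_const.mul contDiffOn_uE))
    (innerSL ℝ (E := E3))

/-- The fibre form of the flat metric: `δ_y = ⟪·,·⟫` on `T_y (ℝ³∖0) = ℝ³`. [folklore] -/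
def flatInner (y : P3) : TangentSpace 𝓘(ℝ, E3) y →L[ℝ] TangentSpace 𝓘(ℝ, E3) y →L[ℝ] ℝ :=
  show E3 →L[ℝ] E3 →L[ℝ] ℝ from innerSL ℝ (E := E3)

/-- The fibre form of the cylinder metric: `(g_c)_y = e^{2u(y)} ⟪·,·⟫`. [folklore] -/
def cylInner (y : P3) : TangentSpace 𝓘(ℝ, E3) y →L[ℝ] TangentSpace 𝓘(ℝ, E3) y →L[ℝ] ℝ :=
  show E3 →L[ℝ] E3 →L[ℝ] ℝ from Real.exp (2 * uE (y : E3)) • innerSL ℝ (E := E3)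

/-- Unfolding lemma for `flatInner`. [folklore] -/
@[simp] theorem flatInner_apply (y : P3) (v w : E3) : flatInner y v w = ⟪v, w⟫ := rfl

/-- Unfolding lemma for `cylInner`. [folklore] -/
@[simp] theorem cylInner_apply (y : P3) (v w : E3) :
    cylInner y v w = Real.exp (2 * uE (y : E3)) * ⟪v, w⟫ := rfl

/-- `flatInner = G0` on the nose. [folklore] -/
theorem flatInner_eq (y : P3) : flatInner y = G0 y := rfl

/-- `cylInner = Gc` on the nose. [folklore] -/
theorem cylInner_eq (y : P3) : cylInner y = Real.exp (2 * uE (y : E3)) • G0 y := rfl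

/-- The flat metric `δ` on `ℝ³ ∖ {0}`. [folklore] -/
def flat3 : PseudoRiemannianMetric 𝓘(ℝ, E3) ∞ E3 (TangentSpace 𝓘(ℝ, E3) : P3 → Type _) where
  val := flatInner
  symm y v w := by
    change @inner ℝ E3 _ v w = @inner ℝ E3 _ w v
    exact real_inner_comm _ _
  nondegenerate y v hv := by
    have h : @inner ℝ E3 _ v v = 0 := hv v
    exact inner_self_eq_zero.mp h
  contMDiff := OpensSection.contMDiff_bilinSection punctured _ contMDiff_const

/-- **The round cylinder metric** `g_c = (2/|y|²) δ` on `ℝ³ ∖ {0}` (`≅ S²(√2) × ℝ` via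
`y ↦ (√2 y/|y|, √2 log |y|)`), spelled `e^{2u} δ`. [folklore] -/
def cyl3 : PseudoRiemannianMetric 𝓘(ℝ, E3) ∞ E3 (TangentSpace 𝓘(ℝ, E3) : P3 → Type _) where
  val := cylInner
  symm y v w := by
    change Real.exp (2 * uE y) * @inner ℝ E3 _ v w = Real.exp (2 * uE y) * @inner ℝ E3 _ w v
    rw [real_inner_comm]
  nondegenerate y v hv := by
    have h : Real.exp (2 * uE y) * @inner ℝ E3 _ v v = 0 := hv v
    rcases mul_eq_zero.mp h with h | h
    · exact absurd h (Real.exp_pos _).ne'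
    · exact inner_self_eq_zero.mp h
  contMDiff := by
    refine OpensSection.contMDiff_bilinSection punctured (fun y ↦ Gc y) ?_
    exact contDiffOn_Gc.contMDiffOn.comp_contMDiff contMDiff_subtype_val fun y ↦ coe_ne_zero y

/-- `flat3.val = G0`. [folklore] -/
theorem flat3_val (y : P3) : flat3.val y = G0 y := rfl

/-- `cyl3.val = e^{2u} G0`. [folklore] -/
theorem cyl3_val (y : P3) : cyl3.val y = Real.exp (2 * uE (y : E3)) • G0 y := rfl

/-- `δ_y(v,w) = ⟪v,w⟫`. [folklore] -/
theorem flat3_apply (y : P3) (v w : E3) : flat3.val y v w = ⟪v, w⟫ := rfl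

/-- `(g_c)_y(v,w) = 2⟪v,w⟫/|y|²`. [folklore] -/
theorem cyl3_apply (y : P3) (v w : E3) : cyl3.val y v w = 2 / ‖(y : E3)‖ ^ 2 * ⟪v, w⟫ := by
  change Real.exp (2 * uE y) * ⟪v, w⟫ = _
  rw [exp_two_uE (coe_ne_zero y)]

/-- The cylinder metric is positive definite. [folklore] -/
theorem isRiemannian_cyl3 : cyl3.IsRiemannian := fun y v hv ↦ by
  rw [cyl3_apply]
  exact mul_pos (div_pos (by norm_num) (normSq_pos y)) (real_inner_self_pos.mpr hv)

/-- The flat metric is positive definite. [folklore] -/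
theorem isRiemannian_flat3 : flat3.IsRiemannian := fun y v hv ↦ by
  rw [flat3_apply]; exact real_inner_self_pos.mpr hv

/-- Levi-Civita instance for `δ`. [folklore] -/
instance : flat3.HasLeviCivita := flat3.hasLeviCivita

/-- Levi-Civita instance for `g_c`. [folklore] -/
instance : cyl3.HasLeviCivita := cyl3.hasLeviCivita

/-! ### Flat base: `Ric(δ) = 0`, `Hess_δ = D²`, `Δ_δ = Σ ∂ᵢ∂ᵢ`, `δ⁻¹(α,β) = Σ α(eᵢ)β(eᵢ)` -/

/-- The standard basis of `ℝ³`. [folklore] -/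
abbrev e3 : Module.Basis (Fin 3) ℝ E3 := (EuclideanSpace.basisFun (Fin 3) ℝ).toBasis

/-- `e3 i` is the `i`-th coordinate vector. [folklore] -/
theorem e3_apply (i : Fin 3) : e3 i = EuclideanSpace.single i 1 := by
  simp [e3]

/-- `Ric(δ) = 0`. [folklore] -/
theorem ricci_flat3 (x : P3) (Y Z : E3) : flat3.ricci x Y Z = 0 := by
  rw [OpensChart.ricci_eq_ricAt flat3_val x, MetricCoord.ricAt_constMetric]
  rfl

/-- `Hess_δ = D²`. [folklore] -/
theorem hessian_flat3 (x : P3) {f : P3 → ℝ} {Φ : E3 → ℝ} (hf : ∀ y : P3, f y = Φ y)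
    (hΦ : ContDiffAt ℝ 2 Φ x) (Y Z : E3) :
    flat3.hessian f x Y Z = fderiv ℝ (fderiv ℝ Φ) x Y Z := by
  rw [OpensChart.hessian_eq_hessAt flat3_val x hf hΦ, MetricCoord.hessAt_constMetric]

/-- `Δ_δ = Σ ∂ᵢ∂ᵢ`. [folklore] -/
theorem dalembertian_flat3 (x : P3) {f : P3 → ℝ} {Φ : E3 → ℝ} (hf : ∀ y : P3, f y = Φ y)
    (hΦ : ContDiffAt ℝ 2 Φ x) :
    flat3.dalembertian f x = ∑ i, fderiv ℝ (fderiv ℝ Φ) x (e3 i) (e3 i) := by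
  rw [OpensChart.dalembertian_eq_lapAt flat3_val x hf hΦ,
    MetricCoord.lapAt_constMetric _ e3 innerSL_basisFun_orthonormal]

/-- `δ⁻¹(α,β) = Σ α(eᵢ)β(eᵢ)`. [folklore] -/
theorem innerDual_flat3 (x : P3) (α β : E3 →L[ℝ] ℝ) :
    flat3.innerDual x (α : E3 →ₗ[ℝ] ℝ) (β : E3 →ₗ[ℝ] ℝ) = ∑ i, α (e3 i) * β (e3 i) := by
  rw [OpensChart.innerDual_eq_sharpAt flat3_val x,
    MetricCoord.apply_sharpAt_constMetric _ e3 innerSL_basisFun_orthonormal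
      (fun v w ↦ real_inner_comm w v)]

/-! ### Sums over the standard basis -/

/-- `Σᵢ ⟪x,eᵢ⟫² = |x|²`. [folklore] -/
theorem sum_inner_e3_sq (x : E3) : ∑ i, ⟪x, e3 i⟫ ^ 2 = ‖x‖ ^ 2 := by
  simp only [e3_apply, EuclideanSpace.inner_single_right, EuclideanSpace.norm_sq_eq]
  simp

/-- `Σᵢ ⟪eᵢ,eᵢ⟫ = 3`. [folklore] -/
theorem sum_inner_e3_e3 : ∑ i : Fin 3, ⟪(e3 i : E3), e3 i⟫ = 3 := by
  simp [e3_apply]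

/-- `Σᵢ ⟪x,eᵢ⟫⟪Y,eᵢ⟫ = ⟪x,Y⟫`. [folklore] -/
theorem sum_inner_mul_inner_e3 (x Y : E3) : ∑ i, ⟪x, e3 i⟫ * ⟪Y, e3 i⟫ = ⟪x, Y⟫ := by
  simp only [e3_apply, EuclideanSpace.inner_single_right]
  simp [EuclideanSpace.inner_eq_star_dotProduct, dotProduct, mul_comm]

/-! ### The conformal exponent as a function on `ℝ³ ∖ {0}` -/

/-- `u` on the punctured space. [folklore] -/
def wP (y : P3) : ℝ := uE y

/-- Unfolding lemma for `wP`. [folklore] -/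
theorem wP_eq (y : P3) : wP y = uE y := rfl

/-- `d(wP)(v) = −⟪x,v⟫/|x|²`. [folklore] -/
theorem mvfderiv_wP (x : P3) (v : E3) :
    mvfderiv 𝓘(ℝ, E3) wP x v = -⟪(x : E3), v⟫ / ‖(x : E3)‖ ^ 2 := by
  rw [OpensChart.mvfderiv_eq x wP uE wP_eq ((hasFDerivAt_uE (coe_ne_zero x)).differentiableAt) v,
    fderiv_uE_apply (coe_ne_zero x)]

/-- `Σᵢ D²u(eᵢ,eᵢ) = −1/|x|²`. [folklore] -/
theorem laplacian_uE (x : P3) : ∑ i, fderiv ℝ (fderiv ℝ uE) x (e3 i) (e3 i) = -1 / ‖(x : E3)‖ ^ 2 := by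
  have hx := coe_ne_zero x
  have hn : ‖(x : E3)‖ ≠ 0 := (norm_pos x).ne'
  have h : ∀ i, fderiv ℝ (fderiv ℝ uE) x (e3 i) (e3 i) =
      -(1 / ‖(x : E3)‖ ^ 2) * ⟪(e3 i : E3), e3 i⟫ + (2 / ‖(x : E3)‖ ^ 4) * ⟪(x : E3), e3 i⟫ ^ 2 := by
    intro i; rw [fderiv_fderiv_uE_apply hx]; ring
  simp_rw [h, Finset.sum_add_distrib, ← Finset.mul_sum, sum_inner_e3_e3, sum_inner_e3_sq]
  field_simp
  ring

/-- `Σᵢ du(eᵢ)² = 1/|x|²`. [folklore] -/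
theorem gradnormSq_uE (x : P3) : ∑ i, fderiv ℝ uE x (e3 i) * fderiv ℝ uE x (e3 i) = 1 / ‖(x : E3)‖ ^ 2 := by
  have hx := coe_ne_zero x
  have hn : ‖(x : E3)‖ ≠ 0 := (norm_pos x).ne'
  have h : ∀ i, fderiv ℝ uE x (e3 i) * fderiv ℝ uE x (e3 i) =
      (1 / ‖(x : E3)‖ ^ 4) * ⟪(x : E3), e3 i⟫ ^ 2 := by
    intro i; rw [fderiv_uE_apply hx]; ring
  simp_rw [h, ← Finset.mul_sum, sum_inner_e3_sq]
  field_simp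

/-! ### The Ricci tensor of the cylinder: `Ric(g_c)(Y,Z) = ⟪Y,Z⟫/|x|² − ⟪x,Y⟫⟪x,Z⟫/|x|⁴`,
i.e. `Ric = ½ g_c − ½ dz ⊗ dz` with `dz = √2⟪x,·⟫/|x|²` -/

/-- **The Ricci tensor of the round cylinder** `g_c = (2/|y|²) δ` on `ℝ³ ∖ {0}`:
`Ric(g_c)_x(Y,Z) = ⟪Y,Z⟫/|x|² − ⟪x,Y⟫⟪x,Z⟫/|x|⁴`, i.e. `Ric = ½ g_c − ½ dz ⊗ dz` with
`dz = √2⟪x,·⟫/|x|²` (the `S²(√2)` factor has Gauss curvature `½`, the `ℝ` factor is flat); from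
Besse's conformal law (Thm. 1.159 (d)) applied to `g_c = e^{2u} δ`. [cite: Besse1987, Thm. 1.159 (d)] -/
theorem ricci_cyl3 (x : P3) (Y Z : E3) :
    cyl3.ricci x Y Z = ⟪Y, Z⟫ / ‖(x : E3)‖ ^ 2 - ⟪(x : E3), Y⟫ * ⟪(x : E3), Z⟫ / ‖(x : E3)‖ ^ 4 := by
  have hx := coe_ne_zero x
  have hρ : ‖(x : E3)‖ ^ 2 ≠ 0 := (normSq_pos x).ne'
  have hu : ContDiffOn ℝ ∞ uE (punctured : Set E3) := contDiffOn_uE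
  have h := OpensChart.ricci_conformalRepr_exp flat3_val cyl3_val hu (w := wP) wP_eq x Y Z
  rw [h, ricci_flat3, hessian_flat3 x wP_eq (contDiffAt_uE hx), fderiv_fderiv_uE_apply hx,
    mvfderiv_wP, mvfderiv_wP, dalembertian_flat3 x wP_eq (contDiffAt_uE hx), laplacian_uE]
  have hmv : (mvfderiv 𝓘(ℝ, E3) wP x).toLinearMap = ((fderiv ℝ uE x : E3 →L[ℝ] ℝ) : E3 →ₗ[ℝ] ℝ) := by
    apply LinearMap.ext; intro v
    exact OpensChart.mvfderiv_eq x wP uE wP_eq ((hasFDerivAt_uE hx).differentiableAt) v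
  rw [hmv, innerDual_flat3, gradnormSq_uE, flat3_apply, finrank_euclideanSpace_fin]
  push_cast
  field_simp
  ring

/-- **The radial direction is `Ric`-null**: `Ric(g_c)_x(Y, x) = 0` — the cylinder is a DEGENERATE
three-dimensional soliton (`Ric` has the eigenvalues `(½, ½, 0)`). [folklore] -/
theorem ricci_cyl3_pos (x : P3) (Y : E3) : cyl3.ricci x Y (x : E3) = 0 := by
  have hn : ‖(x : E3)‖ ≠ 0 := (norm_pos x).ne'
  rw [ricci_cyl3, real_inner_self_eq_norm_sq]
  field_simp
  rw [real_inner_comm]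
  ring

/-! ### Scalar curvature `R(g_c) = 1` -/

/-- `R(δ) = 0`. [folklore] -/
theorem scalarCurvature_flat3 (x : P3) : flat3.scalarCurvature x = 0 := by
  rw [OpensChart.scalarCurvature_eq_scalAt flat3_val x, MetricCoord.scalAt_constMetric]

/-- **`R(g_c) = 1`** on `ℝ³ ∖ {0}`. [folklore] -/
theorem scalarCurvature_cyl3 (x : P3) : cyl3.scalarCurvature x = 1 := by
  have hx := coe_ne_zero x
  have hρ : ‖(x : E3)‖ ^ 2 ≠ 0 := (normSq_pos x).ne'
  have hu : ContDiffOn ℝ ∞ uE (punctured : Set E3) := contDiffOn_uE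
  have h := OpensChart.scalarCurvature_conformalRepr_exp flat3_val cyl3_val hu (w := wP) wP_eq x
  have hmv : (mvfderiv 𝓘(ℝ, E3) wP x).toLinearMap = ((fderiv ℝ uE x : E3 →L[ℝ] ℝ) : E3 →ₗ[ℝ] ℝ) := by
    apply LinearMap.ext; intro v
    exact OpensChart.mvfderiv_eq x wP uE wP_eq ((hasFDerivAt_uE hx).differentiableAt) v
  rw [h, scalarCurvature_flat3, dalembertian_flat3 x wP_eq (contDiffAt_uE hx), laplacian_uE, hmv,
    innerDual_flat3, gradnormSq_uE, finrank_euclideanSpace_fin, wP_eq, exp_two_uE hx]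
  push_cast
  field_simp
  ring

/-! ### The potential `f = L²/2 + 1`, `L = log |y|` -/

/-- `L(y) = log |y|` (as `½ log 2 − u`, to reuse the calculus of `u`). [folklore] -/
def LE (y : E3) : ℝ := 2⁻¹ * Real.log 2 - uE y

/-- The shrinker potential of the cylinder: `f = (log|y|)²/2 + 1 = z²/4 + 1`, `z = √2 log |y|`. [folklore] -/
def fE (y : E3) : ℝ := LE y ^ 2 / 2 + 1

/-- The potential on the punctured space. [folklore] -/
def fP (y : P3) : ℝ := fE y

/-- Unfolding lemma for `fP`. [folklore] -/
theorem fP_eq (y : P3) : fP y = fE y := rfl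

/-- `L = log |y|`. [folklore] -/
theorem LE_eq_log {y : E3} (hy : y ≠ 0) : LE y = Real.log ‖y‖ := by
  have hy' : 0 < ‖y‖ := norm_pos_iff.mpr hy
  rw [LE, uE, Real.log_pow]; push_cast; ring

/-- `L` is smooth off the origin. [folklore] -/
theorem contDiffAt_LE {y : E3} (hy : y ≠ 0) {n : ℕ∞ω} : ContDiffAt ℝ n LE y :=
  contDiffAt_const.sub (contDiffAt_uE hy)

/-- `f` is smooth off the origin. [folklore] -/
theorem contDiffAt_fE {y : E3} (hy : y ≠ 0) {n : ℕ∞ω} : ContDiffAt ℝ n fE y :=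
  (((contDiffAt_LE hy).pow 2).div_const 2).add contDiffAt_const

/-- `fP` is smooth. [folklore] -/
theorem contMDiff_fP : ContMDiff 𝓘(ℝ, E3) 𝓘(ℝ) ∞ fP := by
  have h : ContDiffOn ℝ ∞ fE {y : E3 | y ≠ 0} := fun y hy ↦ (contDiffAt_fE hy).contDiffWithinAt
  exact h.contMDiffOn.comp_contMDiff contMDiff_subtype_val fun y ↦ coe_ne_zero y

/-- `dL_y = |y|⁻² ⟪y,·⟫`. [folklore] -/
theorem hasFDerivAt_LE {y : E3} (hy : y ≠ 0) : HasFDerivAt LE ((‖y‖ ^ 2)⁻¹ • innerSL ℝ y) y := by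
  have h := (hasFDerivAt_uE hy).const_sub (2⁻¹ * Real.log 2)
  refine h.congr_fderiv ?_
  rw [neg_smul, neg_neg]

/-- `dL_y(v) = ⟪y,v⟫/|y|²`. [folklore] -/
theorem fderiv_LE_apply {y : E3} (hy : y ≠ 0) (v : E3) : fderiv ℝ LE y v = ⟪y, v⟫ / ‖y‖ ^ 2 := by
  rw [(hasFDerivAt_LE hy).fderiv, smul_apply, innerSL_apply_apply, smul_eq_mul]
  ring

/-- `df_y = L |y|⁻² ⟪y,·⟫`. [folklore] -/
theorem hasFDerivAt_fE {y : E3} (hy : y ≠ 0) :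
    HasFDerivAt fE ((LE y * (‖y‖ ^ 2)⁻¹) • innerSL ℝ y) y := by
  have h := (((hasFDerivAt_LE hy).pow 2).mul_const (2⁻¹ : ℝ)).add_const (1 : ℝ)
  have hfun : fE = fun y ↦ LE y ^ 2 * 2⁻¹ + 1 := by
    funext y; rw [fE, div_eq_mul_inv]
  rw [hfun]
  refine h.congr_fderiv ?_
  ext v
  simp only [smul_apply, innerSL_apply_apply, smul_eq_mul, nsmul_eq_mul, Nat.cast_ofNat,
    pow_one, Nat.add_one_sub_one]
  ring

/-- `df_y(v) = L ⟪y,v⟫/|y|²`. [folklore] -/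
theorem fderiv_fE_apply {y : E3} (hy : y ≠ 0) (v : E3) : fderiv ℝ fE y v = LE y * ⟪y, v⟫ / ‖y‖ ^ 2 := by
  rw [(hasFDerivAt_fE hy).fderiv, smul_apply, innerSL_apply_apply, smul_eq_mul]
  ring

/-- `D²L = −D²u`. [folklore] -/
theorem fderiv_fderiv_LE_apply {x : E3} (hx : x ≠ 0) (Y Z : E3) :
    fderiv ℝ (fderiv ℝ LE) x Y Z = ⟪Y, Z⟫ / ‖x‖ ^ 2 - 2 * ⟪x, Y⟫ * ⟪x, Z⟫ / ‖x‖ ^ 4 := by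
  have hev : fderiv ℝ LE =ᶠ[𝓝 x] fun y ↦ -fderiv ℝ uE y := by
    filter_upwards [isOpen_compl_singleton.mem_nhds hx] with y hy
    rw [(hasFDerivAt_LE hy).fderiv, (hasFDerivAt_uE hy).fderiv, neg_smul, neg_neg]
  rw [hev.fderiv_eq, fderiv_fun_neg, neg_apply, neg_apply, fderiv_fderiv_uE_apply hx]
  ring

/-- `D²f(Y,Z) = dL(Y) dL(Z) + L D²L(Y,Z)`. [folklore] -/
theorem fderiv_fderiv_fE_apply {x : E3} (hx : x ≠ 0) (Y Z : E3) :
    fderiv ℝ (fderiv ℝ fE) x Y Z =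
      (⟪x, Y⟫ / ‖x‖ ^ 2) * (⟪x, Z⟫ / ‖x‖ ^ 2) +
        LE x * (⟪Y, Z⟫ / ‖x‖ ^ 2 - 2 * ⟪x, Y⟫ * ⟪x, Z⟫ / ‖x‖ ^ 4) := by
  -- `dfE = L • dL` near `x`
  have hev : fderiv ℝ fE =ᶠ[𝓝 x] fun y ↦ (LE y) • fderiv ℝ LE y := by
    filter_upwards [isOpen_compl_singleton.mem_nhds hx] with y hy
    rw [(hasFDerivAt_fE hy).fderiv, (hasFDerivAt_LE hy).fderiv, smul_smul]
  have hL : DifferentiableAt ℝ LE x := (hasFDerivAt_LE hx).differentiableAt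
  have hdL : DifferentiableAt ℝ (fderiv ℝ LE) x := by
    have hc : ContDiffAt ℝ 2 LE x := contDiffAt_LE hx
    exact (hc.fderiv_right (m := 1) (by norm_num)).differentiableAt one_ne_zero
  rw [hev.fderiv_eq, fderiv_fun_smul hL hdL]
  simp only [add_apply, smul_apply, smul_eq_mul, ContinuousLinearMap.smulRight_apply]
  rw [fderiv_fderiv_LE_apply hx, (hasFDerivAt_LE hx).fderiv]
  simp only [smul_apply, smul_eq_mul, innerSL_apply_apply]
  field_simp
  ring

/-! ### The conformal factor `r = e^{u} = √2/|y|` and the Hessian of `f` for `g_c` -/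

/-- `r = e^u` (`= √2/|y|`), so that `g_c = r² δ`. [folklore] -/
def rP (y : P3) : ℝ := Real.exp (uE y)

/-- `r > 0`. [folklore] -/
theorem rP_pos (y : P3) : 0 < rP y := Real.exp_pos _

/-- `r² = e^{2u}`. [folklore] -/
theorem rP_sq (y : P3) : rP y ^ 2 = Real.exp (2 * uE (y : E3)) := by
  rw [rP, sq, ← Real.exp_add]; ring_nf

/-- `g_c = r² δ`. [folklore] -/
theorem cyl3_val_eq_rP_sq (y : P3) : cyl3.val y = rP y ^ 2 • flat3.val y := by
  rw [rP_sq]; rfl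

/-- `d(e^u) = e^u du`. [folklore] -/
theorem hasFDerivAt_exp_uE {y : E3} (hy : y ≠ 0) :
    HasFDerivAt (fun y ↦ Real.exp (uE y)) (Real.exp (uE y) • (-(‖y‖ ^ 2)⁻¹ • innerSL ℝ y)) y :=
  (Real.hasDerivAt_exp _).comp_hasFDerivAt y (hasFDerivAt_uE hy)

/-- `r` is differentiable. [folklore] -/
theorem mdifferentiableAt_rP (x : P3) : MDifferentiableAt 𝓘(ℝ, E3) 𝓘(ℝ, ℝ) rP x := by
  have h : ContDiffOn ℝ ∞ (fun y ↦ Real.exp (uE y)) {y : E3 | y ≠ 0} :=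
    Real.contDiff_exp.comp_contDiffOn contDiffOn_uE
  have h2 : ContMDiff 𝓘(ℝ, E3) 𝓘(ℝ) ∞ rP :=
    h.contMDiffOn.comp_contMDiff contMDiff_subtype_val fun y ↦ coe_ne_zero y
  exact h2.mdifferentiableAt (by simp)

/-- `dr(u) = −r⟪x,u⟫/|x|²`. [folklore] -/
theorem mvfderiv_rP (x : P3) (u : E3) :
    mvfderiv 𝓘(ℝ, E3) rP x u = rP x * (-⟪(x : E3), u⟫ / ‖(x : E3)‖ ^ 2) := by
  have hx := coe_ne_zero x
  rw [OpensChart.mvfderiv_eq x rP (fun y ↦ Real.exp (uE y)) (fun _ ↦ rfl)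
    (hasFDerivAt_exp_uE hx).differentiableAt u, (hasFDerivAt_exp_uE hx).fderiv]
  simp only [smul_apply, smul_eq_mul, innerSL_apply_apply, rP]
  ring

/-- `df(u) = L⟪x,u⟫/|x|²` on the manifold. [folklore] -/
theorem mvfderiv_fP (x : P3) (u : E3) :
    mvfderiv 𝓘(ℝ, E3) fP x u = LE x * ⟪(x : E3), u⟫ / ‖(x : E3)‖ ^ 2 := by
  have hx := coe_ne_zero x
  rw [OpensChart.mvfderiv_eq x fP fE fP_eq (hasFDerivAt_fE hx).differentiableAt u, fderiv_fE_apply hx]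

/-- `fP` is `C²` at every point. [folklore] -/
theorem contMDiffAt_two_fP (x : P3) : ContMDiffAt 𝓘(ℝ, E3) 𝓘(ℝ, ℝ) 2 fP x :=
  (contMDiff_fP.of_le (by norm_cast)).contMDiffAt

/-- `d(fP) = d(fE)` as continuous linear maps. [folklore] -/
theorem mvfderiv_fP_eq (x : P3) : mvfderiv 𝓘(ℝ, E3) fP x = (fderiv ℝ fE x : E3 →L[ℝ] ℝ) := by
  apply ContinuousLinearMap.ext; intro v
  exact OpensChart.mvfderiv_eq x fP fE fP_eq (hasFDerivAt_fE (coe_ne_zero x)).differentiableAt v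

/-- The position vector as a tangent vector at `x`. [folklore] -/
def pos (x : P3) : TangentSpace 𝓘(ℝ, E3) x := show E3 from (x : E3)

/-- `♯_δ (drP) = −(r/|x|²) x`. [folklore] -/
theorem sharp_flat3_mvfderiv_rP (x : P3) :
    flat3.sharp x (mvfderiv 𝓘(ℝ, E3) rP x).toLinearMap = (-(rP x) / ‖(x : E3)‖ ^ 2) • pos x := by
  refine flat3.sharp_eq_of_forall x _ _ fun w ↦ ?_
  rw [map_smul, smul_apply, smul_eq_mul]
  change _ * ⟪(x : E3), w⟫ = mvfderiv 𝓘(ℝ, E3) rP x w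
  rw [mvfderiv_rP]
  ring

/-- **The `g_c`-Hessian of the potential on the diagonal**: `Hess_{g_c} f (u,u) = ⟪x,u⟫²/|x|⁴`
(`= ½ dz(u)²`, `dz = √2⟪x,·⟫/|x|²`). [folklore] -/
theorem hessian_cyl3_fP_self (x : P3) (u : TangentSpace 𝓘(ℝ, E3) x) :
    cyl3.hessian fP x u u = ⟪(x : E3), u⟫ ^ 2 / ‖(x : E3)‖ ^ 4 := by
  have hx := coe_ne_zero x
  have hn : ‖(x : E3)‖ ≠ 0 := (norm_pos x).ne'
  have hr : rP x ≠ 0 := (rP_pos x).ne'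
  have h := GGSU.hessian_conformal_apply_self (g := flat3) (ĝ := cyl3) (r := rP) (x := x)
    cyl3_val_eq_rP_sq (mdifferentiableAt_rP x) hr (contMDiffAt_two_fP x) u
  have hxx : mvfderiv 𝓘(ℝ, E3) fP x (pos x) = LE x := by
    rw [mvfderiv_fP]
    change LE x * ⟪(x : E3), (x : E3)⟫ / ‖(x : E3)‖ ^ 2 = _
    rw [real_inner_self_eq_norm_sq]
    field_simp
  rw [sharp_flat3_mvfderiv_rP, map_smul, smul_eq_mul, hxx, mvfderiv_fP, mvfderiv_rP,
    hessian_flat3 x fP_eq (contDiffAt_fE hx), fderiv_fderiv_fE_apply hx, flat3_apply] at h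
  rw [h]
  field_simp
  ring

/-! ### The soliton equation `Ric + Hess f = ½ g_c` -/

/-- The soliton equation on the diagonal. [folklore] -/
theorem soliton_self (x : P3) (u : TangentSpace 𝓘(ℝ, E3) x) :
    cyl3.ricci x u u + cyl3.hessian fP x u u = (1 / 2 : ℝ) * cyl3.val x u u := by
  have hn : ‖(x : E3)‖ ≠ 0 := (norm_pos x).ne'
  rw [ricci_cyl3, hessian_cyl3_fP_self, cyl3_apply]
  field_simp
  ring

/-- **The round cylinder is a gradient shrinking soliton**: `Ric(g_c) + Hess_{g_c} f = ½ g_c` on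
`ℝ³ ∖ {0}`, `f = (log|y|)²/2 + 1` (polarisation of `soliton_self`). [folklore] -/
theorem soliton (x : P3) (X Y : TangentSpace 𝓘(ℝ, E3) x) :
    cyl3.ricci x X Y + cyl3.hessian fP x X Y = (1 / 2 : ℝ) * cyl3.val x X Y := by
  have h1 := soliton_self x (X + Y)
  have h2 := soliton_self x X
  have h3 := soliton_self x Y
  simp only [map_add, LinearMap.add_apply, add_apply] at h1
  have hRs : cyl3.ricci x Y X = cyl3.ricci x X Y := (cyl3.ricci_symm_holds (by norm_cast) x).eq Y X
  have hHs : cyl3.hessian fP x Y X = cyl3.hessian fP x X Y :=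
    (cyl3.hessian_symm_holds (contMDiffAt_two_fP x)).eq Y X
  have hgs : cyl3.val x Y X = cyl3.val x X Y := cyl3.symm x Y X
  rw [hRs, hHs, hgs] at h1
  linarith

/-! ### `|∇f|²_{g_c} = L²/2` and the normalisation `R + |∇f|² = f` -/

/-- **`|∇f|²_{g_c} = (log|y|)²/2`**. [folklore] -/
theorem gradSq_cyl3_fP (x : P3) : cyl3.gradSq fP x = LE x ^ 2 / 2 := by
  have hx := coe_ne_zero x
  have hn : ‖(x : E3)‖ ≠ 0 := (norm_pos x).ne'
  have hc : Real.exp (2 * uE (x : E3)) ≠ 0 := (Real.exp_pos _).ne'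
  rw [PseudoRiemannianMetric.gradSq, mvfderiv_fP_eq, OpensChart.innerDual_eq_sharpAt (G := Gc) cyl3_val x]
  have hsh : MetricCoord.sharpAt Gc x (fderiv ℝ fE x) =
      (Real.exp (2 * uE (x : E3)))⁻¹ • MetricCoord.sharpAt G0 x (fderiv ℝ fE x) :=
    MetricCoord.sharpAt_conformal (G := G0) (c := fun y ↦ Real.exp (2 * uE y))
      (OpensChart.isInvertible_repr flat3_val x) (OpensChart.isInvertible_repr (G := Gc) cyl3_val x) hc _
  rw [hsh, map_smul, smul_eq_mul,
    MetricCoord.apply_sharpAt_constMetric _ e3 innerSL_basisFun_orthonormal (fun v w ↦ real_inner_comm w v),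
    exp_two_uE hx]
  have hterm : ∀ i, fderiv ℝ fE x (e3 i) * fderiv ℝ fE x (e3 i) =
      (LE x ^ 2 / ‖(x : E3)‖ ^ 4) * ⟪(x : E3), e3 i⟫ ^ 2 := by
    intro i; rw [fderiv_fE_apply hx]; field_simp
  simp_rw [hterm, ← Finset.mul_sum, sum_inner_e3_sq]
  field_simp

/-- **The normalisation** `R + |∇f|² = f` for the cylinder. [folklore] -/
theorem normalisation (x : P3) : cyl3.scalarCurvature x + cyl3.gradSq fP x = fP x := by
  rw [scalarCurvature_cyl3, gradSq_cyl3_fP, fP_eq, fE]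
  ring

/-- `f ≥ 1`, with equality exactly on the unit sphere `{|y| = 1}` (`= {z = 0} ≅ S²(√2)`). [folklore] -/
theorem one_le_fP (x : P3) : 1 ≤ fP x := by
  rw [fP_eq, fE]; nlinarith [sq_nonneg (LE x)]

section Topology

/-- `ℝ³ ∖ {0}` is not compact. [folklore] -/
instance : NoncompactSpace P3 := by
  refine ⟨fun hc ↦ ?_⟩
  have hK : IsCompact ((Subtype.val : P3 → E3) '' univ) := hc.image continuous_subtype_val
  rw [image_univ, Subtype.range_coe_subtype] at hK
  have hb : Bornology.IsBounded ({(0 : E3)}ᶜ : Set E3) := hK.isBounded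
  have huniv : Bornology.IsBounded (univ : Set E3) := by
    rw [← compl_union_self {(0 : E3)}]
    exact hb.union Bornology.isBounded_singleton
  exact NormedSpace.unbounded_univ ℝ E3 huniv

/-- `ℝ³ ∖ {0}` is connected. [folklore] -/
instance : ConnectedSpace P3 := by
  have h : IsConnected ({(0 : E3)}ᶜ : Set E3) := by
    refine isConnected_compl_singleton_of_one_lt_rank ?_ 0
    rw [← Module.finrank_eq_rank, finrank_euclideanSpace_fin]
    norm_num
  exact isConnected_iff_connectedSpace.mp h

end Topology

end RoundCylinderThree

end Literature.Geometry.Riemannian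

end
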